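/-
Copyright (c) 2026 the pub-hodgecm-mathlib formalisation cell (harness21).  Prover seat hodgecm-mathlib-K2Liu-p02 (g0): Track B «K2-LIT», #184♮ = hLiu418,
organ O41.1 PART A′ «D9 LIFT» of socket #41 `sig_K2LiuSiegelEisensteinContinuation` (steward K2Liu-p01 (g0) 2026-09-03T22:54:55Z ∕ 23:04:41Z «lifts to
`HA` ∕ `unipDelta` ∕ `weylDelta` by `conjE_eq` + `eq_of_blk_eq` once D9 is ★»; REPORT-FIRST 2026-09-03T23:14Z → LEAD F0P6-plan (g10), K2Liu-plan (g0)).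
-/
import Literature.NumberTheory.K2Lit.SiegelDoubledUnipotent
import Summits.HodgeConjecture.HodgeConjecture.Theorems.K2LiuSiegelDoubledBlkUnitary
import Summits.HodgeConjecture.HodgeConjecture.Theorems.K2LiuSiegelBruhatCellsUnitary
import Summits.HodgeConjecture.HodgeConjecture.Theorems.K2LiuSiegelBigCellFree
import HarnessLib

/-!
# Crux `HLiu418`, Track B road `K2_Liu`, unit U6, organ O41.1 (PART A′): THE BIG BRUHAT CELL INSIDE `H(𝔸)` —
# `h ∈ H(𝔸)` with invertible lower-left frame block is `p · w_Δ · u`, `p ∈ P_Δ(𝔸)`, `u ∈ N_Δ(𝔸)` (existence; uniqueness by ★ p07)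

Cell `hodgecm-mathlib`, crux item hLiu418 = `stmt-HodgeConjecture-24832`; prover K2Liu-p02 (g0).  THEOREMS ONLY; lane
`--supports stmt-HodgeConjecture-24832 --as helper`.  This is the reading of ★ PART A (`K2LiuSiegelBruhatCells.bigCell_eq`, frame algebra over a
commutative ring with `⅟2`) and ★ PART B1 (`K2LiuSiegelBruhatCellsUnitary.unipCoordinate_skew`, unitarity of the factors) in the vocabulary of ★ D9
(`K2Lit.SiegelDoubledUnipotent`: `unipDelta = N_Δ(𝔸)`, `weylDelta = w_Δ`, `siegelDelta = P_Δ(𝔸)`) on the doubled unitary group `HA = H(𝔸) ≤ GL_{n+n}(𝔸_L)`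
of ★ `GRConstruction`, through ★ K2Liu-p09's bridge `K2LiuSiegelDoubledBlkUnitary` (`cstar_blk`, `exists_mem_HA_of_cstar`).

FRAMES.  `blk h` is the block matrix of `h` (`Fin n ⊕ Fin n`); the TRIANGULAR FRAME is `E₁ · blk h · E₂` (`E₁ = (1 0; −1 1)`, `E₂ = (1 0; 1 1)`, ★
`conjE_eq`), in which `P_Δ(𝔸)` = «lower-left block `0`» (★ `isSiegelDelta_iff_conj`), `N_Δ(𝔸)` = `(1 X; 0 1)` (★ `mem_unipDelta_iff`), `w_Δ` = `W = (1 0; −2 −1)`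
(★ `conjE_blk_weylDelta`).  With `T_𝔸 = gramR ⊗ 1` and `σ = c ⊗ 1 = conjAdele`, membership in `H(𝔸)` is `σ(blk h)ᵀ (T_𝔸 ⊕ −T_𝔸) blk h = T_𝔸 ⊕ −T_𝔸`
(★ `cstar_blk`), i.e. in the frame `F^* J_F F = J_F` with the frame form `J_F = ᵗE₂ (T_𝔸 ⊕ −T_𝔸) E₂ = (0 −T_𝔸; −T_𝔸 −T_𝔸)` of ★ B1 (`frame_unitary_of_unitary`).

* §0 (any commutative ring `R`, `σ : R →+* R`, `T`) `E₁_map`, `E₂_map`; `frame_unitary_of_unitary` (unframed ⇒ framed unitarity) and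
  `unframe_unitary_of_frame_unitary` (framed ⇒ unframed).
* §1 `frame_blk_unitary` — the frame of every `h ∈ H(𝔸)` is unitary for `J_F`.
* §2 **`exists_siegel_weylDelta_unip`** — BIG CELL, EXISTENCE: if the lower-left frame block `C_h` of `h ∈ H(𝔸)` has `IsUnit C_h.det`, then
  `h = p * weylDelta * u` with `p ∈ siegelDelta`, `u ∈ unipDelta`, and the frame of `u` is `(1 X; 0 1)`, `X = C_h⁻¹ D_h − ⅟2` (★ `bigCell_eq`; `u` is BUILT in
  `H(𝔸)` from its matrix by ★ `exists_mem_HA_of_cstar`, its unitarity being ★ B1 `unipCoordinate_skew` + `unip_unitary_iff`; `p := h u⁻¹ w_Δ` is then Siegel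
  because its frame is the Siegel factor of ★ `bigCell_eq`).
* §3 `unip_unique_of_eq` ∕ `siegel_unique_of_eq` — UNIQUENESS of the coordinates `(p, u)`, a two-line corollary of ★ K2Liu-p07's freeness
  `K2LiuSiegelBigCellFree.eq_of_isSiegelDelta_weylDelta_mul` (cited, not re-proved).
So `P_Δ(𝔸) w_Δ N_Δ(𝔸) = {h ∈ H(𝔸) : C_h ∈ GL_n(𝔸_L)}` with unique coordinates — the big cell of `P_Δ\H/P_Δ` consumed by O41.3 (`M(s) = ∫_{N_Δ(𝔸)} f(w_Δ u h) du`)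
and O41.4∕O41.8 (the `w_Δ`-orbit of the constant term) [GPSR87 Part A §§1–2], [MW95 II.1.7].

HONEST LABEL.  Count-neutral helper; `HC_CM` is proved only modulo the 7 printed citations (hLiu418 = 24832, h413 = 24833) until rung 0 closes.

## References
* [GelbartPiatetskishapiroRallis1987] S. Gelbart, I. Piatetski-Shapiro, S. Rallis, LNM 1254 (1987), Part A §§1–2 (the doubled group, `P`, `w`, the big cell).
* [MoeglinWaldspurger1995] C. Mœglin, J.-L. Waldspurger, CUP (1995), I.2.1, II.1.7.
* [KudlaRallis1994] S. Kudla, S. Rallis, Ann. Math. 140 (1994), §1.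
-/

set_option autoImplicit false

noncomputable section

open scoped Matrix
open NumberField IsDedekindDomain

namespace Summit.HodgeConjecture.HodgeConjecture.Cruxes.HLiu418.K2LiuSiegelBruhatCellsDelta

open Literature.NumberTheory.Automorphic Literature.NumberTheory.Automorphic.UnitaryGroup
open Literature.NumberTheory.GelbartRogawski1991 Literature.NumberTheory.GelbartRogawski1991.GRConstruction
open Literature.NumberTheory.K2Lit.SiegelDoubled
open UnitaryDualPair
open Summit.HodgeConjecture.HodgeConjecture.Cruxes.HLiu418.K2LiuSiegelDoubledBlkUnitary
open Summit.HodgeConjecture.HodgeConjecture.Cruxes.HLiu418.K2LiuSiegelBruhatCells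
open Summit.HodgeConjecture.HodgeConjecture.Cruxes.HLiu418.K2LiuSiegelBruhatCellsUnitary
open Summit.HodgeConjecture.HodgeConjecture.Cruxes.HLiu418.K2LiuSiegelBigCellFree

/-! ## §0 Frame transport of unitarity (any commutative ring) -/

section Ring

variable {R : Type*} [CommRing R] (σ : R →+* R) {ι : Type*} [Fintype ι] [DecidableEq ι]

omit [Fintype ι] in
/-- `σ(E₁) = E₁` (entries `0, ±1`). [folklore] -/
theorem E₁_map : (Matrix.fromBlocks (1 : Matrix ι ι R) 0 (-1) (1 : Matrix ι ι R)).map σ = Matrix.fromBlocks (1 : Matrix ι ι R) 0 (-1) (1 : Matrix ι ι R) := by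
  rw [Matrix.fromBlocks_map, Matrix.map_neg _ (map_neg σ), Matrix.map_one σ (map_zero σ) (map_one σ), Matrix.map_zero σ (map_zero σ)]

omit [Fintype ι] in
/-- `σ(E₂) = E₂` (entries `0, 1`). [folklore] -/
theorem E₂_map : (Matrix.fromBlocks (1 : Matrix ι ι R) 0 1 (1 : Matrix ι ι R)).map σ = Matrix.fromBlocks (1 : Matrix ι ι R) 0 1 (1 : Matrix ι ι R) := by
  rw [Matrix.fromBlocks_map, Matrix.map_one σ (map_zero σ) (map_one σ), Matrix.map_zero σ (map_zero σ)]

/-- **Unframed ⇒ framed unitarity**: if `σ(B)ᵀ (T ⊕ −T) B = T ⊕ −T` then the frame `F = E₁ B E₂` satisfies `σ(F)ᵀ J_F F = J_F` for the frame form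
`J_F = ᵗE₂ (T ⊕ −T) E₂ = (0 −T; −T −T)` (★ B1 `frameForm_eq`; `E₂ E₁ = 1`). [cite: GelbartPiatetskishapiroRallis1987, Part A §1] -/
theorem frame_unitary_of_unitary (T : Matrix ι ι R) {B : Matrix (ι ⊕ ι) (ι ⊕ ι) R}
    (h : (B.map σ)ᵀ * Matrix.fromBlocks T 0 0 (-T) * B = Matrix.fromBlocks T 0 0 (-T)) :
    ((Matrix.fromBlocks (1 : Matrix ι ι R) 0 (-1) (1 : Matrix ι ι R) * B * Matrix.fromBlocks (1 : Matrix ι ι R) 0 1 (1 : Matrix ι ι R)).map σ)ᵀ * Matrix.fromBlocks 0 (-T) (-T) (-T) *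
        (Matrix.fromBlocks (1 : Matrix ι ι R) 0 (-1) (1 : Matrix ι ι R) * B * Matrix.fromBlocks (1 : Matrix ι ι R) 0 1 (1 : Matrix ι ι R)) =
      Matrix.fromBlocks 0 (-T) (-T) (-T) := by
  rw [← frameForm_eq T, Matrix.map_mul, Matrix.map_mul, E₁_map, E₂_map, Matrix.transpose_mul, Matrix.transpose_mul]
  calc (Matrix.fromBlocks (1 : Matrix ι ι R) 0 1 (1 : Matrix ι ι R))ᵀ * ((B.map σ)ᵀ * (Matrix.fromBlocks (1 : Matrix ι ι R) 0 (-1) (1 : Matrix ι ι R))ᵀ) *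
          ((Matrix.fromBlocks (1 : Matrix ι ι R) 0 1 (1 : Matrix ι ι R))ᵀ * Matrix.fromBlocks T 0 0 (-T) * Matrix.fromBlocks (1 : Matrix ι ι R) 0 1 (1 : Matrix ι ι R)) *
          (Matrix.fromBlocks (1 : Matrix ι ι R) 0 (-1) (1 : Matrix ι ι R) * B * Matrix.fromBlocks (1 : Matrix ι ι R) 0 1 (1 : Matrix ι ι R))
        = (Matrix.fromBlocks (1 : Matrix ι ι R) 0 1 (1 : Matrix ι ι R))ᵀ * ((B.map σ)ᵀ *
            ((Matrix.fromBlocks (1 : Matrix ι ι R) 0 1 (1 : Matrix ι ι R) * Matrix.fromBlocks (1 : Matrix ι ι R) 0 (-1) (1 : Matrix ι ι R))ᵀ * Matrix.fromBlocks T 0 0 (-T) *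
              (Matrix.fromBlocks (1 : Matrix ι ι R) 0 1 (1 : Matrix ι ι R) * Matrix.fromBlocks (1 : Matrix ι ι R) 0 (-1) (1 : Matrix ι ι R))) * B) *
            Matrix.fromBlocks (1 : Matrix ι ι R) 0 1 (1 : Matrix ι ι R) := by
          rw [Matrix.transpose_mul]; simp only [Matrix.mul_assoc]
    _ = (Matrix.fromBlocks (1 : Matrix ι ι R) 0 1 (1 : Matrix ι ι R))ᵀ * Matrix.fromBlocks T 0 0 (-T) * Matrix.fromBlocks (1 : Matrix ι ι R) 0 1 (1 : Matrix ι ι R) := by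
          rw [E₂_mul_E₁, Matrix.transpose_one, Matrix.one_mul, Matrix.mul_one, h, Matrix.mul_assoc]

/-- **Framed ⇒ unframed unitarity**: if `σ(F)ᵀ J_F F = J_F` then `B = E₂ F E₁` satisfies `σ(B)ᵀ (T ⊕ −T) B = T ⊕ −T` (`E₁ E₂ = 1 = E₂ E₁`).
[cite: GelbartPiatetskishapiroRallis1987, Part A §1] -/
theorem unframe_unitary_of_frame_unitary (T : Matrix ι ι R) {F : Matrix (ι ⊕ ι) (ι ⊕ ι) R}
    (h : (F.map σ)ᵀ * Matrix.fromBlocks 0 (-T) (-T) (-T) * F = Matrix.fromBlocks 0 (-T) (-T) (-T)) :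
    ((Matrix.fromBlocks (1 : Matrix ι ι R) 0 1 (1 : Matrix ι ι R) * F * Matrix.fromBlocks (1 : Matrix ι ι R) 0 (-1) (1 : Matrix ι ι R)).map σ)ᵀ * Matrix.fromBlocks T 0 0 (-T) *
        (Matrix.fromBlocks (1 : Matrix ι ι R) 0 1 (1 : Matrix ι ι R) * F * Matrix.fromBlocks (1 : Matrix ι ι R) 0 (-1) (1 : Matrix ι ι R)) =
      Matrix.fromBlocks T 0 0 (-T) := by
  rw [Matrix.map_mul, Matrix.map_mul, E₁_map, E₂_map, Matrix.transpose_mul, Matrix.transpose_mul]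
  calc (Matrix.fromBlocks (1 : Matrix ι ι R) 0 (-1) (1 : Matrix ι ι R))ᵀ * ((F.map σ)ᵀ * (Matrix.fromBlocks (1 : Matrix ι ι R) 0 1 (1 : Matrix ι ι R))ᵀ) * Matrix.fromBlocks T 0 0 (-T) *
          (Matrix.fromBlocks (1 : Matrix ι ι R) 0 1 (1 : Matrix ι ι R) * F * Matrix.fromBlocks (1 : Matrix ι ι R) 0 (-1) (1 : Matrix ι ι R))
        = (Matrix.fromBlocks (1 : Matrix ι ι R) 0 (-1) (1 : Matrix ι ι R))ᵀ *
            ((F.map σ)ᵀ * ((Matrix.fromBlocks (1 : Matrix ι ι R) 0 1 (1 : Matrix ι ι R))ᵀ * Matrix.fromBlocks T 0 0 (-T) * Matrix.fromBlocks (1 : Matrix ι ι R) 0 1 (1 : Matrix ι ι R)) * F) *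
            Matrix.fromBlocks (1 : Matrix ι ι R) 0 (-1) (1 : Matrix ι ι R) := by
          simp only [Matrix.mul_assoc]
    _ = (Matrix.fromBlocks (1 : Matrix ι ι R) 0 1 (1 : Matrix ι ι R) * Matrix.fromBlocks (1 : Matrix ι ι R) 0 (-1) (1 : Matrix ι ι R))ᵀ * Matrix.fromBlocks T 0 0 (-T) *
          (Matrix.fromBlocks (1 : Matrix ι ι R) 0 1 (1 : Matrix ι ι R) * Matrix.fromBlocks (1 : Matrix ι ι R) 0 (-1) (1 : Matrix ι ι R)) := by
          rw [frameForm_eq, h, ← frameForm_eq, Matrix.transpose_mul]; simp only [Matrix.mul_assoc]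
    _ = Matrix.fromBlocks T 0 0 (-T) := by
          rw [E₂_mul_E₁, Matrix.transpose_one, Matrix.one_mul, Matrix.mul_one]

/-- `E₁ (E₂ M E₁) E₂ = M`. [folklore] -/
theorem frame_unframe (M : Matrix (ι ⊕ ι) (ι ⊕ ι) R) :
    Matrix.fromBlocks (1 : Matrix ι ι R) 0 (-1) (1 : Matrix ι ι R) * (Matrix.fromBlocks (1 : Matrix ι ι R) 0 1 (1 : Matrix ι ι R) * M * Matrix.fromBlocks (1 : Matrix ι ι R) 0 (-1) (1 : Matrix ι ι R)) *
        Matrix.fromBlocks (1 : Matrix ι ι R) 0 1 (1 : Matrix ι ι R) = M := by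
  calc _ = (Matrix.fromBlocks (1 : Matrix ι ι R) 0 (-1) (1 : Matrix ι ι R) * Matrix.fromBlocks (1 : Matrix ι ι R) 0 1 (1 : Matrix ι ι R)) * M *
          (Matrix.fromBlocks (1 : Matrix ι ι R) 0 (-1) (1 : Matrix ι ι R) * Matrix.fromBlocks (1 : Matrix ι ι R) 0 1 (1 : Matrix ι ι R)) := by simp only [Matrix.mul_assoc]
    _ = M := by rw [E₁_mul_E₂, Matrix.one_mul, Matrix.mul_one]

/-- `(E₂ n(X) E₁)(E₂ n(Y) E₁) = E₂ n(X + Y) E₁`. [folklore] -/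
theorem unframe_unip_mul (X Y : Matrix ι ι R) :
    Matrix.fromBlocks (1 : Matrix ι ι R) 0 1 (1 : Matrix ι ι R) * Matrix.fromBlocks 1 X 0 1 * Matrix.fromBlocks (1 : Matrix ι ι R) 0 (-1) (1 : Matrix ι ι R) *
        (Matrix.fromBlocks (1 : Matrix ι ι R) 0 1 (1 : Matrix ι ι R) * Matrix.fromBlocks 1 Y 0 1 * Matrix.fromBlocks (1 : Matrix ι ι R) 0 (-1) (1 : Matrix ι ι R)) =
      Matrix.fromBlocks (1 : Matrix ι ι R) 0 1 (1 : Matrix ι ι R) * Matrix.fromBlocks 1 (X + Y) 0 1 * Matrix.fromBlocks (1 : Matrix ι ι R) 0 (-1) (1 : Matrix ι ι R) := by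
  calc _ = Matrix.fromBlocks (1 : Matrix ι ι R) 0 1 (1 : Matrix ι ι R) * (Matrix.fromBlocks 1 X 0 1 *
          (Matrix.fromBlocks (1 : Matrix ι ι R) 0 (-1) (1 : Matrix ι ι R) * Matrix.fromBlocks (1 : Matrix ι ι R) 0 1 (1 : Matrix ι ι R)) * Matrix.fromBlocks 1 Y 0 1) *
          Matrix.fromBlocks (1 : Matrix ι ι R) 0 (-1) (1 : Matrix ι ι R) := by simp only [Matrix.mul_assoc]
    _ = _ := by rw [E₁_mul_E₂, Matrix.mul_one, unip_mul_unip, Matrix.mul_assoc]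

end Ring

/-! ## §1 The frame of an element of `H(𝔸)` is unitary -/

section Doubled

variable (L : Type) [Field L] [NumberField L] [IsCMField L]
variable {N M n : ℕ} (e : Fin N × Fin M ≃ Fin n)
  (dV : Fin N → L) (hdV : ∀ i, IsCMField.complexConj L (dV i) = dV i)
  (dW : Fin M → L) (hdW : ∀ i, IsCMField.complexConj L (dW i) = dW i)

/-- **The frame `E₁ · blk h · E₂` of `h ∈ H(𝔸)` is unitary for the frame form** `J_F = (0 −T_𝔸; −T_𝔸 −T_𝔸)` (★ `cstar_blk` transported by
`frame_unitary_of_unitary`). [cite: GelbartPiatetskishapiroRallis1987, Part A §1] -/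
theorem frame_blk_unitary (h : HA L e dV hdV dW hdW) :
    ((Matrix.fromBlocks (1 : Matrix (Fin n) (Fin n) (AdeleRing (𝓞 L) L)) 0 (-1) (1 : Matrix (Fin n) (Fin n) (AdeleRing (𝓞 L) L)) * blk L e dV hdV dW hdW h * Matrix.fromBlocks (1 : Matrix (Fin n) (Fin n) (AdeleRing (𝓞 L) L)) 0 1 (1 : Matrix (Fin n) (Fin n) (AdeleRing (𝓞 L) L))).map
          (conjAdele (Fp L) L (IsCMField.complexConj L)))ᵀ *
        Matrix.fromBlocks 0 (-(gramR L e dV hdV dW hdW).map ((algebraMap L (AdeleRing (𝓞 L) L)).comp (algebraMap (Fp L) L)))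
          (-(gramR L e dV hdV dW hdW).map ((algebraMap L (AdeleRing (𝓞 L) L)).comp (algebraMap (Fp L) L)))
          (-(gramR L e dV hdV dW hdW).map ((algebraMap L (AdeleRing (𝓞 L) L)).comp (algebraMap (Fp L) L))) *
        (Matrix.fromBlocks (1 : Matrix (Fin n) (Fin n) (AdeleRing (𝓞 L) L)) 0 (-1) (1 : Matrix (Fin n) (Fin n) (AdeleRing (𝓞 L) L)) * blk L e dV hdV dW hdW h * Matrix.fromBlocks (1 : Matrix (Fin n) (Fin n) (AdeleRing (𝓞 L) L)) 0 1 (1 : Matrix (Fin n) (Fin n) (AdeleRing (𝓞 L) L))) =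
      Matrix.fromBlocks 0 (-(gramR L e dV hdV dW hdW).map ((algebraMap L (AdeleRing (𝓞 L) L)).comp (algebraMap (Fp L) L)))
        (-(gramR L e dV hdV dW hdW).map ((algebraMap L (AdeleRing (𝓞 L) L)).comp (algebraMap (Fp L) L)))
        (-(gramR L e dV hdV dW hdW).map ((algebraMap L (AdeleRing (𝓞 L) L)).comp (algebraMap (Fp L) L))) :=
  frame_unitary_of_unitary _ _ (cstar_blk L e dV hdV dW hdW h)

/-! ## §2 The big cell inside `H(𝔸)`: existence of the coordinates `(p, u)` -/

/-- **THE BIG BRUHAT CELL OF `P_Δ\H(𝔸)/P_Δ` — existence.**  Let `h ∈ H(𝔸)` and let `C_h` be the lower-left block of its triangular frame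
`E₁ · blk h · E₂` (`= h₂₁ + h₂₂ − h₁₁ − h₁₂`, ★ `conjE_eq`).  If `det C_h ∈ 𝔸_L^×` then `h = p · w_Δ · u` with `p ∈ P_Δ(𝔸)`, `u ∈ N_Δ(𝔸)`, and the frame of `u` is
`(1 X; 0 1)` with `X = C_h⁻¹ D_h − ⅟2` (`D_h` the lower-right frame block).  Proof: ★ `bigCell_eq` factors the frame as `(a b; 0 d) · W · (1 X; 0 1)`; by ★ B1
`unipCoordinate_skew` (the frame is unitary, `frame_blk_unitary`; `T_𝔸` is invertible for a non-degenerate pair) `X` is `T_𝔸`-skew, so `(1 X; 0 1)` unframed is the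
block matrix of some `u ∈ H(𝔸)` (★ `exists_mem_HA_of_cstar`), which lies in `N_Δ(𝔸)`; `p := h u⁻¹ w_Δ` has frame `(a b; 0 d) W (1 X;0 1)(1 −X; 0 1) W = (a b; 0 d)`,
so `p ∈ P_Δ(𝔸)` (★ `isSiegelDelta_iff_conj`), and `p w_Δ u = h` (`w_Δ² = 1`). [cite: GelbartPiatetskishapiroRallis1987, Part A §§1–2] [cite: MoeglinWaldspurger1995, II.1.7] -/
theorem exists_siegel_weylDelta_unip (hdV0 : ∀ i, dV i ≠ 0) (hdW0 : ∀ i, dW i ≠ 0) (h : HA L e dV hdV dW hdW)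
    (hC : IsUnit (Matrix.fromBlocks (1 : Matrix (Fin n) (Fin n) (AdeleRing (𝓞 L) L)) 0 (-1) (1 : Matrix (Fin n) (Fin n) (AdeleRing (𝓞 L) L)) * blk L e dV hdV dW hdW h *
      Matrix.fromBlocks (1 : Matrix (Fin n) (Fin n) (AdeleRing (𝓞 L) L)) 0 1 (1 : Matrix (Fin n) (Fin n) (AdeleRing (𝓞 L) L))).toBlocks₂₁.det) :
    ∃ p u : HA L e dV hdV dW hdW, p ∈ siegelDelta L e dV hdV dW hdW ∧ u ∈ unipDelta L e dV hdV dW hdW ∧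
      h = p * weylDelta L e dV hdV dW hdW * u ∧
      Matrix.fromBlocks (1 : Matrix (Fin n) (Fin n) (AdeleRing (𝓞 L) L)) 0 (-1) (1 : Matrix (Fin n) (Fin n) (AdeleRing (𝓞 L) L)) * blk L e dV hdV dW hdW u * Matrix.fromBlocks (1 : Matrix (Fin n) (Fin n) (AdeleRing (𝓞 L) L)) 0 1 (1 : Matrix (Fin n) (Fin n) (AdeleRing (𝓞 L) L)) =
        Matrix.fromBlocks 1
          ((Matrix.fromBlocks (1 : Matrix (Fin n) (Fin n) (AdeleRing (𝓞 L) L)) 0 (-1) (1 : Matrix (Fin n) (Fin n) (AdeleRing (𝓞 L) L)) * blk L e dV hdV dW hdW h *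
                Matrix.fromBlocks (1 : Matrix (Fin n) (Fin n) (AdeleRing (𝓞 L) L)) 0 1 (1 : Matrix (Fin n) (Fin n) (AdeleRing (𝓞 L) L))).toBlocks₂₁⁻¹ *
              (Matrix.fromBlocks (1 : Matrix (Fin n) (Fin n) (AdeleRing (𝓞 L) L)) 0 (-1) (1 : Matrix (Fin n) (Fin n) (AdeleRing (𝓞 L) L)) * blk L e dV hdV dW hdW h *
                Matrix.fromBlocks (1 : Matrix (Fin n) (Fin n) (AdeleRing (𝓞 L) L)) 0 1 (1 : Matrix (Fin n) (Fin n) (AdeleRing (𝓞 L) L))).toBlocks₂₂ -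
            (⅟ (2 : AdeleRing (𝓞 L) L)) • 1)
          0 1 := by
  set σ := conjAdele (Fp L) L (IsCMField.complexConj L) with hσ
  set T : Matrix (Fin n) (Fin n) (AdeleRing (𝓞 L) L) :=
    (gramR L e dV hdV dW hdW).map ((algebraMap L (AdeleRing (𝓞 L) L)).comp (algebraMap (Fp L) L)) with hT
  set F : Matrix (Fin n ⊕ Fin n) (Fin n ⊕ Fin n) (AdeleRing (𝓞 L) L) :=
    Matrix.fromBlocks (1 : Matrix (Fin n) (Fin n) (AdeleRing (𝓞 L) L)) 0 (-1) (1 : Matrix (Fin n) (Fin n) (AdeleRing (𝓞 L) L)) * blk L e dV hdV dW hdW h * Matrix.fromBlocks (1 : Matrix (Fin n) (Fin n) (AdeleRing (𝓞 L) L)) 0 1 (1 : Matrix (Fin n) (Fin n) (AdeleRing (𝓞 L) L)) with hF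
  set X : Matrix (Fin n) (Fin n) (AdeleRing (𝓞 L) L) := F.toBlocks₂₁⁻¹ * F.toBlocks₂₂ - (⅟ (2 : AdeleRing (𝓞 L) L)) • 1 with hX
  -- `T_𝔸` is invertible (non-degenerate pair)
  have hTu : IsUnit T.det := by
    rw [hT, ← RingHom.mapMatrix_apply, ← RingHom.map_det]
    exact (isUnit_det_gram (Fp L) e (isUnit_det_realDiagonal L dV hdV hdV0) (isUnit_det_realDiagonal L dW hdW hdW0)).map _
  -- the frame in blocks, its big-cell factorisation (★ PART A) and its unitarity (§1)
  have hFb : F = Matrix.fromBlocks F.toBlocks₁₁ F.toBlocks₁₂ F.toBlocks₂₁ F.toBlocks₂₂ := (Matrix.fromBlocks_toBlocks F).symm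
  have hFu : ((Matrix.fromBlocks F.toBlocks₁₁ F.toBlocks₁₂ F.toBlocks₂₁ F.toBlocks₂₂).map σ)ᵀ * Matrix.fromBlocks 0 (-T) (-T) (-T) *
      Matrix.fromBlocks F.toBlocks₁₁ F.toBlocks₁₂ F.toBlocks₂₁ F.toBlocks₂₂ = Matrix.fromBlocks 0 (-T) (-T) (-T) := by
    rw [← hFb]
    exact frame_blk_unitary L e dV hdV dW hdW h
  -- the `N_Δ`-coordinate is skew (★ PART B1), so `n(X)` is unitary, framed and unframed
  have hXskew : T * X + (X.map σ)ᵀ * T = 0 := unipCoordinate_skew σ T _ _ _ _ hTu hC hFu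
  have hnX := unframe_unitary_of_frame_unitary σ T ((unip_unitary_iff σ T X).2 hXskew)
  -- build `u ∈ H(𝔸)` with `blk u = E₂ n(X) E₁`
  have hXY : Matrix.fromBlocks (1 : Matrix (Fin n) (Fin n) (AdeleRing (𝓞 L) L)) 0 1 (1 : Matrix (Fin n) (Fin n) (AdeleRing (𝓞 L) L)) * Matrix.fromBlocks 1 X 0 1 * Matrix.fromBlocks (1 : Matrix (Fin n) (Fin n) (AdeleRing (𝓞 L) L)) 0 (-1) (1 : Matrix (Fin n) (Fin n) (AdeleRing (𝓞 L) L)) *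
      (Matrix.fromBlocks (1 : Matrix (Fin n) (Fin n) (AdeleRing (𝓞 L) L)) 0 1 (1 : Matrix (Fin n) (Fin n) (AdeleRing (𝓞 L) L)) * Matrix.fromBlocks 1 (-X) 0 1 * Matrix.fromBlocks (1 : Matrix (Fin n) (Fin n) (AdeleRing (𝓞 L) L)) 0 (-1) (1 : Matrix (Fin n) (Fin n) (AdeleRing (𝓞 L) L))) = 1 := by
    rw [unframe_unip_mul, add_neg_cancel, Matrix.fromBlocks_one, Matrix.mul_one, E₂_mul_E₁]
  have hYX : Matrix.fromBlocks (1 : Matrix (Fin n) (Fin n) (AdeleRing (𝓞 L) L)) 0 1 (1 : Matrix (Fin n) (Fin n) (AdeleRing (𝓞 L) L)) * Matrix.fromBlocks 1 (-X) 0 1 * Matrix.fromBlocks (1 : Matrix (Fin n) (Fin n) (AdeleRing (𝓞 L) L)) 0 (-1) (1 : Matrix (Fin n) (Fin n) (AdeleRing (𝓞 L) L)) *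
      (Matrix.fromBlocks (1 : Matrix (Fin n) (Fin n) (AdeleRing (𝓞 L) L)) 0 1 (1 : Matrix (Fin n) (Fin n) (AdeleRing (𝓞 L) L)) * Matrix.fromBlocks 1 X 0 1 * Matrix.fromBlocks (1 : Matrix (Fin n) (Fin n) (AdeleRing (𝓞 L) L)) 0 (-1) (1 : Matrix (Fin n) (Fin n) (AdeleRing (𝓞 L) L))) = 1 := by
    rw [unframe_unip_mul, neg_add_cancel, Matrix.fromBlocks_one, Matrix.mul_one, E₂_mul_E₁]
  obtain ⟨u, hu⟩ := exists_mem_HA_of_cstar L e dV hdV dW hdW hXY hYX hnX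
  have hfu : Matrix.fromBlocks (1 : Matrix (Fin n) (Fin n) (AdeleRing (𝓞 L) L)) 0 (-1) (1 : Matrix (Fin n) (Fin n) (AdeleRing (𝓞 L) L)) * blk L e dV hdV dW hdW u * Matrix.fromBlocks (1 : Matrix (Fin n) (Fin n) (AdeleRing (𝓞 L) L)) 0 1 (1 : Matrix (Fin n) (Fin n) (AdeleRing (𝓞 L) L)) =
      Matrix.fromBlocks 1 X 0 1 := by
    rw [hu, frame_unframe]
  have huN : u ∈ unipDelta L e dV hdV dW hdW := (mem_unipDelta_iff L e dV hdV dW hdW u).2 ⟨X, hfu⟩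
  -- the block matrix of `u⁻¹` is the unframed `n(−X)`
  have hui : blk L e dV hdV dW hdW u⁻¹ =
      Matrix.fromBlocks (1 : Matrix (Fin n) (Fin n) (AdeleRing (𝓞 L) L)) 0 1 (1 : Matrix (Fin n) (Fin n) (AdeleRing (𝓞 L) L)) * Matrix.fromBlocks 1 (-X) 0 1 * Matrix.fromBlocks (1 : Matrix (Fin n) (Fin n) (AdeleRing (𝓞 L) L)) 0 (-1) (1 : Matrix (Fin n) (Fin n) (AdeleRing (𝓞 L) L)) :=
    Matrix.left_inv_eq_left_inv (by rw [← blk_mul, inv_mul_cancel, blk_one]) (by rw [hu]; exact hYX)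
  -- the Siegel factor
  set p : HA L e dV hdV dW hdW := h * u⁻¹ * weylDelta L e dV hdV dW hdW with hp
  have hhp : h = p * weylDelta L e dV hdV dW hdW * u := by
    rw [hp, mul_assoc (h * u⁻¹), weylDelta_mul_weylDelta, mul_one, inv_mul_cancel_right]
  -- the frame of `h` in the big cell (★ PART A)
  have hFcell : Matrix.fromBlocks (1 : Matrix (Fin n) (Fin n) (AdeleRing (𝓞 L) L)) 0 (-1) (1 : Matrix (Fin n) (Fin n) (AdeleRing (𝓞 L) L)) * blk L e dV hdV dW hdW h * Matrix.fromBlocks (1 : Matrix (Fin n) (Fin n) (AdeleRing (𝓞 L) L)) 0 1 (1 : Matrix (Fin n) (Fin n) (AdeleRing (𝓞 L) L)) =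
      Matrix.fromBlocks (F.toBlocks₁₁ + (2 : AdeleRing (𝓞 L) L) • (F.toBlocks₁₁ * X - F.toBlocks₁₂)) (F.toBlocks₁₁ * X - F.toBlocks₁₂) 0
          (-((⅟ (2 : AdeleRing (𝓞 L) L)) • F.toBlocks₂₁)) *
        Matrix.fromBlocks 1 0 (-2) (-1) * Matrix.fromBlocks 1 X 0 1 := by
    rw [← hF]
    conv_lhs => rw [hFb, bigCell_eq _ _ _ _ hC]
  have hPf : Matrix.fromBlocks (1 : Matrix (Fin n) (Fin n) (AdeleRing (𝓞 L) L)) 0 (-1) (1 : Matrix (Fin n) (Fin n) (AdeleRing (𝓞 L) L)) * blk L e dV hdV dW hdW p * Matrix.fromBlocks (1 : Matrix (Fin n) (Fin n) (AdeleRing (𝓞 L) L)) 0 1 (1 : Matrix (Fin n) (Fin n) (AdeleRing (𝓞 L) L)) =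
      Matrix.fromBlocks (F.toBlocks₁₁ + (2 : AdeleRing (𝓞 L) L) • (F.toBlocks₁₁ * X - F.toBlocks₁₂)) (F.toBlocks₁₁ * X - F.toBlocks₁₂) 0
        (-((⅟ (2 : AdeleRing (𝓞 L) L)) • F.toBlocks₂₁)) := by
    rw [hp, conj_blk_mul, conj_blk_mul, hui, frame_unframe, conjE_blk_weylDelta, hFcell,
      Matrix.mul_assoc (Matrix.fromBlocks _ _ 0 _ * Matrix.fromBlocks 1 0 (-2) (-1)), unip_mul_unip_neg, Matrix.mul_one,
      Matrix.mul_assoc (Matrix.fromBlocks _ _ 0 _), weyl_mul_weyl, Matrix.mul_one]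
  have hP : p ∈ siegelDelta L e dV hdV dW hdW := by
    rw [mem_siegelDelta_iff, isSiegelDelta_iff_conj, hPf, Matrix.toBlocks_fromBlocks₂₁]
  exact ⟨p, u, hP, huN, hhp, hfu⟩

/-! ## §3 Uniqueness of the coordinates (after ★ K2Liu-p07 `K2LiuSiegelBigCellFree`) -/

/-- **Uniqueness of the `N_Δ`-coordinate**: `p w_Δ u = p' w_Δ u'` with `p, p' ∈ P_Δ(𝔸)`, `u, u' ∈ N_Δ(𝔸)` forces `u = u'` — the big cell is FREE
(★ `K2LiuSiegelBigCellFree.eq_of_isSiegelDelta_weylDelta_mul` applied to `p'⁻¹ p`). [cite: GelbartPiatetskishapiroRallis1987, Part A §1] -/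
theorem unip_unique_of_eq {p p' u u' : HA L e dV hdV dW hdW} (hp : p ∈ siegelDelta L e dV hdV dW hdW) (hp' : p' ∈ siegelDelta L e dV hdV dW hdW)
    (hu : u ∈ unipDelta L e dV hdV dW hdW) (hu' : u' ∈ unipDelta L e dV hdV dW hdW)
    (h : p * weylDelta L e dV hdV dW hdW * u = p' * weylDelta L e dV hdV dW hdW * u') : u = u' := by
  refine eq_of_isSiegelDelta_weylDelta_mul L e dV hdV dW hdW (p := p'⁻¹ * p)
    ((mem_siegelDelta_iff L e dV hdV dW hdW _).1 (mul_mem (inv_mem hp') hp)) hu hu' ?_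
  rw [show p'⁻¹ * p * (weylDelta L e dV hdV dW hdW * u) = p'⁻¹ * (p * weylDelta L e dV hdV dW hdW * u) by simp only [mul_assoc], h,
    mul_assoc, inv_mul_cancel_left]

/-- **Uniqueness of the Siegel coordinate**: `p w_Δ u = p' w_Δ u'` (same hypotheses) forces `p = p'`. [cite: GelbartPiatetskishapiroRallis1987, Part A §1] -/
theorem siegel_unique_of_eq {p p' u u' : HA L e dV hdV dW hdW} (hp : p ∈ siegelDelta L e dV hdV dW hdW) (hp' : p' ∈ siegelDelta L e dV hdV dW hdW)
    (hu : u ∈ unipDelta L e dV hdV dW hdW) (hu' : u' ∈ unipDelta L e dV hdV dW hdW)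
    (h : p * weylDelta L e dV hdV dW hdW * u = p' * weylDelta L e dV hdV dW hdW * u') : p = p' := by
  have huu : u = u' := unip_unique_of_eq L e dV hdV dW hdW hp hp' hu hu' h
  rw [← huu] at h
  exact mul_right_cancel (mul_right_cancel h)

end Doubled

end Summit.HodgeConjecture.HodgeConjecture.Cruxes.HLiu418.K2LiuSiegelBruhatCellsDelta

end
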